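/-
Copyright (c) 2026. All rights reserved.
Released under Apache 2.0 license as described in the file LICENSE.
Authors: abc-iut cell, seat abc-iut-L6-t15 (gen 13): [IUTchIII] Remark 3.6.2 (i) (b), the schema
`Remark362i_Sunits` (FACT-LIST row F-0427, L-F register row LF6-44) — head-form instances at the genuine
`S`-units and the decision of the schema over `ℚ` and at real places — proof-only.
-/
import Literature.IUT.LogThetaLattice.GlobalFrobenioidModelsRmk362iGenuine
import Literature.IUT.LogThetaLattice.GlobalFrobenioidModelsNegative362i
import HarnessLib

/-!
# [IUTchIII] Remark 3.6.2 (i) (b): the schema `Remark362i_Sunits` — head-form certificate (proof-only)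

S. Mochizuki, *Inter-universal Teichmüller Theory III*, kurims manuscript (May 2020), Remark 3.6.2 (i),
p. 109 l. 5–20 [claim: Mochizuki2012, status: disputed]: "the rational function monoid `F^×_mod` of
`𝓕⊛_mod` satisfies the following fundamental property: [the union with `{0}` of] `F^×_mod` admits a natural
additive structure. … this property is not satisfied by … (b) subgroups `Γ ⊆ F^×_mod` — such as, for
instance, the trivial subgroup `{1}` or the subgroup of `S`-units, for `S ⊆ 𝕍_mod` a nonempty finite
subset — that do not arise as the multiplicative group of some subfield of `F_mod`".

abc-iut cell, layer L6, FACT-LIST row **F-0427** = abc-iut-L6-t4's schema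
`GlobalFrobenioidModels.Remark362i_Sunits US := US ≠ ⊤ → ¬ IsAdditivelyClosed F {x | ∃ u ∈ US, ↑u = x}`
(`GlobalFrobenioidModels.lean`, p404192/p405528), whose universal closure is REFUTED in tree
(`not_Remark362i_Sunits_posSubgroup`, `not_forall_Remark362i_Sunits`, p413148) and whose printed content is
carried by the repaired `Remark362i_Sunits'_holds` (p405528), by the module reading
`not_sub_closed_of_not_subfield` (p414631) and by the genuine `S`-unit theorems
`sUnit_not_isAdditivelyClosed` / `modelSUnit_not_isAdditivelyClosed` (p438300).  What the kernel census
(keyed on the conclusion HEAD `Remark362i_Sunits`) did not yet see is an INSTANCE-FORM theorem of the schema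
itself.  PROOF-ONLY file (theorems only; no `def`, no new `Prop` fact, no instance), consuming the above BY
NAME:

* §1 bridge: the primed hypothesis gives the unprimed schema (`remark362i_Sunits_of_exists_nat_not_mem`);
  in characteristic `0` an additively closed `US ∪ {0}` contains every positive integer
  (`exists_mem_coe_eq_natCast_of_isAdditivelyClosed`); the trivial subgroup (`remark362i_Sunits_bot`).
* §2 HEAD-FORM INSTANCES at the genuine number-field model: `Remark362i_Sunits (F := K) Γ` for every
  finite set `S` of finite places and every `Γ ≤ S.unit K` (`remark362i_Sunits_of_le_unit`), and for every
  finite `S ⊆ ModelPlaces K` and every subgroup of model `S`-units (`remark362i_Sunits_of_betaModel_eq_zero`).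
* §3 THE SCHEMA DECIDED OVER `ℚ`: `US ∪ {0}` is additively closed iff `ℚ_{>0} ≤ US`
  (`isAdditivelyClosed_rat_iff_posSubgroup_le`), hence `Remark362i_Sunits (F := ℚ) US ↔ US ≠ ℚ_{>0}`
  (`remark362i_Sunits_rat_iff`) — the refuting witness of record is the UNIQUE failure over the prime field.
* §4 failures beyond `ℚ`: for any field `F` with a ring homomorphism `σ : F →+* ℝ` (e.g. a number field with
  a real place) the `σ`-positive cone `US_σ := {u | 0 < σ u}` is a proper subgroup, is the unit group of NO
  subfield (`-1 ∉ US_σ`), and `US_σ ∪ {0}` IS additively closed (`not_Remark362i_Sunits_posCone`,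
  `posCone_ne_top`, `posCone_not_subfield`): so adding print's exclusion "not the multiplicative group of a
  subfield" to the `+`-only reading would NOT repair the schema — the faithful repair is the module reading
  (closure under `+` and `−`, p414631) or the primed hypothesis (p405528), both PROVED in tree.

HONEST FRAMING: elementary algebra over OUR typing; an instance-form theorem at OUR model is not the print
universal closure (which, as typed, is false); nothing here bears on [IUTchIII] Cor. 3.12 and nothing asserts
abc proved or refuted; typed ≠ proved elsewhere; instantiated ≠ endorsed.
-/

namespace Literature.IUT.LogThetaLattice

namespace GlobalFrobenioidModels

open NumberField IsDedekindDomain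

universe u

/-! ### 1. Bridge: primed hypothesis ⇒ unprimed schema; naturals forced by additive closure -/

section Bridge

variable {F : Type u} [Field F]

/-- **IUTchIII:Rmk3.6.2(i) (b)** (kurims p.109 l.16–18): the repaired hypothesis of abc-iut-L6-t4's
`Remark362i_Sunits'` (some positive integer is not in `US`) yields the UNPRIMED schema `Remark362i_Sunits US`
(by `Remark362i_Sunits'_holds`; the properness hypothesis `US ≠ ⊤` is then not needed). PROVED.
[claim: Mochizuki2012, status: disputed] -/
theorem remark362i_Sunits_of_exists_nat_not_mem [CharZero F] (US : Subgroup Fˣ)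
    (h : ∃ n : ℕ, 0 < n ∧ ∀ u ∈ US, (u : F) ≠ n) : Remark362i_Sunits (F := F) US :=
  fun _ => Remark362i_Sunits'_holds (F := F) US h

/-- **IUTchIII:Rmk3.6.2(i) (b)** (kurims p.109 l.9–13), the mechanism in characteristic `0`: if `US ∪ {0}`
is additively closed then every positive integer `n · 1` is (the value of) a unit of `US` (contrapositive
of `Remark362i_Sunits'_holds`). PROVED. [claim: Mochizuki2012, status: disputed] -/
theorem exists_mem_coe_eq_natCast_of_isAdditivelyClosed [CharZero F] (US : Subgroup Fˣ)
    (h : IsAdditivelyClosed F {x : F | ∃ u ∈ US, (u : F) = x}) (n : ℕ) (hn : 0 < n) :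
    ∃ u ∈ US, (u : F) = n := by
  by_contra hne
  push Not at hne
  exact Remark362i_Sunits'_holds (F := F) US ⟨n, hn, hne⟩ h

/-- **IUTchIII:Rmk3.6.2(i) (b)** (kurims p.109 l.16 «the trivial subgroup `{1}`»): the unprimed schema
at `US = {1}` in characteristic `0` (`2 ∉ {1}`; cf. `not_isAdditivelyClosed_one`). PROVED.
[claim: Mochizuki2012, status: disputed] -/
theorem remark362i_Sunits_bot [CharZero F] : Remark362i_Sunits (F := F) (⊥ : Subgroup Fˣ) := by
  refine remark362i_Sunits_of_exists_nat_not_mem ⊥ ⟨2, two_pos, fun u hu => ?_⟩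
  rw [Subgroup.mem_bot] at hu
  subst hu
  norm_num

end Bridge

/-! ### 2. Head-form instances at the genuine number-field model -/

section Genuine

variable {K : Type u} [Field K] [NumberField K]

/-- **IUTchIII:Rmk3.6.2(i) (b), genuine, HEAD FORM** (kurims p.109 l.16–18 «the subgroup of `S`-units,
for `S ⊆ 𝕍_mod` a [nonempty] finite subset»), Mathlib form: for every finite set `S` of finite places of
the number field `F_mod = K` and every subgroup `Γ ≤ S.unit K` of the `S`-units, the schema
`Remark362i_Sunits (F := K) Γ` holds (by abc-iut-L6-t6's `sUnit_not_isAdditivelyClosed`). PROVED.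
[claim: Mochizuki2012, status: disputed] -/
theorem remark362i_Sunits_of_le_unit (S : Set (HeightOneSpectrum (𝓞 K))) (hS : S.Finite)
    (Γ : Subgroup Kˣ) (hΓ : Γ ≤ S.unit K) : Remark362i_Sunits (F := K) Γ :=
  fun _ => sUnit_not_isAdditivelyClosed S hS Γ hΓ

/-- **IUTchIII:Rmk3.6.2(i) (b), genuine, HEAD FORM at the places MODEL** (kurims p.109 l.16–18;
`𝕍 = ModelPlaces K`, `β_v = betaModel v`, archimedean members of `S` allowed): for every finite
`S ⊆ ModelPlaces K` and every subgroup `Γ` of model `S`-units (`β_v(u) = 0` for `v ∉ S`), the schema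
`Remark362i_Sunits (F := K) Γ` holds (by `modelSUnit_not_isAdditivelyClosed`). PROVED.
[claim: Mochizuki2012, status: disputed] -/
theorem remark362i_Sunits_of_betaModel_eq_zero (S : Set (ModelPlaces K)) (hS : S.Finite)
    (Γ : Subgroup Kˣ) (hΓ : ∀ u ∈ Γ, ∀ v ∉ S, betaModel v (Additive.ofMul u) = 0) :
    Remark362i_Sunits (F := K) Γ :=
  fun _ => modelSUnit_not_isAdditivelyClosed S hS Γ hΓ

end Genuine

/-! ### 3. The schema decided over `ℚ` -/

section RatDecided

/-- Over `ℚ`: a subgroup `US ⊆ ℚ^×` containing a NEGATIVE unit and all positive units is everything.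
Elementary. [claim: Mochizuki2012, status: disputed] -/
theorem eq_top_of_posSubgroup_le_of_exists_neg (US : Subgroup ℚˣ) (hle : Units.posSubgroup ℚ ≤ US)
    (hneg : ∃ u ∈ US, (u : ℚ) < 0) : US = ⊤ := by
  obtain ⟨u, hu, hu0⟩ := hneg
  rw [eq_top_iff]
  intro w _
  rcases lt_trichotomy (0 : ℚ) (w : ℚ) with hw | hw | hw
  · exact hle ((Units.mem_posSubgroup w).mpr hw)
  · exact absurd hw.symm w.ne_zero
  · -- `w = u * (u⁻¹ * w)` with `u⁻¹ * w` positive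
    have hpos : (0 : ℚ) < ((u⁻¹ * w : ℚˣ) : ℚ) := by
      rw [Units.val_mul, Units.val_inv_eq_inv_val]
      exact mul_pos_of_neg_of_neg (inv_lt_zero.mpr hu0) hw
    have hmem : u⁻¹ * w ∈ US := hle ((Units.mem_posSubgroup _).mpr hpos)
    have := US.mul_mem hu hmem
    rwa [mul_inv_cancel_left] at this

/-- **IUTchIII:Rmk3.6.2(i) (b), the schema DECIDED over `ℚ`** (kurims p.109 l.5–8): for a subgroup
`US ⊆ ℚ^×`, `US ∪ {0}` is closed under `+` if and only if `US` contains every positive rational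
(`Units.posSubgroup ℚ ≤ US`; then `US` is `ℚ_{>0}` or `ℚ^×`). (`⇒`: additive closure forces every positive
integer into `US`, hence every quotient of positive integers; `⇐`: a sum of two members is `0`, positive,
or — when a negative unit is present, so that `US = ℚ^×` — any nonzero rational.) PROVED.
[claim: Mochizuki2012, status: disputed] -/
theorem isAdditivelyClosed_rat_iff_posSubgroup_le (US : Subgroup ℚˣ) :
    IsAdditivelyClosed ℚ {x : ℚ | ∃ u ∈ US, (u : ℚ) = x} ↔ Units.posSubgroup ℚ ≤ US := by
  constructor
  · intro h w hw
    rw [Units.mem_posSubgroup] at hw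
    -- numerator and denominator of the positive rational `w` are positive integers, hence in `US`
    have hnum : 0 < (w : ℚ).num := Rat.num_pos.mpr hw
    obtain ⟨a, ha, hav⟩ :=
      exists_mem_coe_eq_natCast_of_isAdditivelyClosed US h (w : ℚ).num.natAbs
        (Int.natAbs_pos.mpr hnum.ne')
    obtain ⟨b, hb, hbv⟩ :=
      exists_mem_coe_eq_natCast_of_isAdditivelyClosed US h (w : ℚ).den (w : ℚ).den_pos
    have hab : ((a * b⁻¹ : ℚˣ) : ℚ) = (w : ℚ) := by
      rw [Units.val_mul, Units.val_inv_eq_inv_val, hav, hbv, ← div_eq_mul_inv]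
      have hn : (((w : ℚ).num.natAbs : ℕ) : ℚ) = ((w : ℚ).num : ℚ) := by
        rw [← Int.cast_natCast, Int.natAbs_of_nonneg hnum.le]
      rw [hn]
      exact Rat.num_div_den (w : ℚ)
    have hw' : w = a * b⁻¹ := Units.ext hab.symm
    rw [hw']
    exact US.mul_mem ha (US.inv_mem hb)
  · intro hle a ha b hb
    by_cases hsum : a + b = 0
    · exact Or.inr hsum
    left
    rcases lt_or_gt_of_ne hsum with hlt | hgt
    · -- a negative sum needs a negative summand from `US`, so `US = ⊤`
      have hneg : ∃ u ∈ US, (u : ℚ) < 0 := by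
        rcases ha with ⟨u, hu, rfl⟩ | ha0
        · rcases hb with ⟨v, hv, rfl⟩ | hb0
          · by_contra hcon
            push Not at hcon
            have hu' := hcon u hu
            have hv' := hcon v hv
            linarith
          · rw [Set.mem_singleton_iff] at hb0
            exact ⟨u, hu, by simpa [hb0] using hlt⟩
        · rw [Set.mem_singleton_iff] at ha0
          rcases hb with ⟨v, hv, rfl⟩ | hb0
          · exact ⟨v, hv, by simpa [ha0] using hlt⟩
          · rw [Set.mem_singleton_iff] at hb0
            exact absurd (by rw [ha0, hb0, add_zero]) hsum
      have htop := eq_top_of_posSubgroup_le_of_exists_neg US hle hneg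
      exact ⟨Units.mk0 (a + b) hsum, htop ▸ Subgroup.mem_top _, Units.val_mk0 _⟩
    · exact ⟨Units.mk0 (a + b) hsum, hle ((Units.mem_posSubgroup _).mpr (by simpa using hgt)),
        Units.val_mk0 _⟩

/-- **IUTchIII:Rmk3.6.2(i) (b), the schema DECIDED over `ℚ`** (kurims p.109): for a subgroup
`US ⊆ ℚ^×`, `Remark362i_Sunits (F := ℚ) US` holds if and only if `US ≠ ℚ_{>0}` — abc-iut-w4-d011's
refuting witness `Units.posSubgroup ℚ` (`not_Remark362i_Sunits_posSubgroup`) is the UNIQUE failure of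
the schema over the prime field. PROVED. [claim: Mochizuki2012, status: disputed] -/
theorem remark362i_Sunits_rat_iff (US : Subgroup ℚˣ) :
    Remark362i_Sunits (F := ℚ) US ↔ US ≠ Units.posSubgroup ℚ := by
  constructor
  · rintro h rfl
    exact not_Remark362i_Sunits_posSubgroup h
  · intro hne htop hclosed
    have hle := (isAdditivelyClosed_rat_iff_posSubgroup_le US).mp hclosed
    -- `ℚ_{>0} ≤ US`, `US ≠ ℚ_{>0}` ⇒ `US` has a non-positive, hence negative, unit ⇒ `US = ⊤`
    have hneg : ∃ u ∈ US, (u : ℚ) < 0 := by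
      by_contra hcon
      push Not at hcon
      apply hne
      refine le_antisymm (fun u hu => ?_) hle
      rw [Units.mem_posSubgroup]
      exact lt_of_le_of_ne (hcon u hu) (u.ne_zero).symm
    exact htop (eq_top_of_posSubgroup_le_of_exists_neg US hle hneg)

end RatDecided

/-! ### 4. Failures beyond `ℚ`: positive cones of real places (not subfield unit groups) -/

section PosCone

variable {F : Type u} [Field F]

/-- **IUTchIII:Rmk3.6.2(i) (b)** (kurims p.109 l.16–20), typing record: for a ring homomorphism
`σ : F →+* ℝ` (a real place) the `σ`-positive cone `(Units.posSubgroup ℝ).comap (Units.map σ)` does not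
contain `-1`, so it is a PROPER subgroup of `F^×`. PROVED. [claim: Mochizuki2012, status: disputed] -/
theorem posCone_ne_top (σ : F →+* ℝ) :
    (Units.posSubgroup ℝ).comap (Units.map (σ : F →* ℝ)) ≠ ⊤ := by
  intro htop
  have hmem : (-1 : Fˣ) ∈ (Units.posSubgroup ℝ).comap (Units.map (σ : F →* ℝ)) :=
    htop ▸ Subgroup.mem_top _
  rw [Subgroup.mem_comap, Units.mem_posSubgroup, Units.coe_map, MonoidHom.coe_coe, Units.val_neg,
    Units.val_one, map_neg, map_one] at hmem
  norm_num at hmem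

/-- **IUTchIII:Rmk3.6.2(i) (b)** (kurims p.109 l.5–8), typing record: the `σ`-positive cone of a real
place `σ : F →+* ℝ` together with `0` IS closed under `+` (`σ(a + b) = σ a + σ b > 0`). PROVED.
[claim: Mochizuki2012, status: disputed] -/
theorem isAdditivelyClosed_posCone (σ : F →+* ℝ) :
    IsAdditivelyClosed F
      {x : F | ∃ u ∈ (Units.posSubgroup ℝ).comap (Units.map (σ : F →* ℝ)), (u : F) = x} := by
  -- membership in the cone's value set `∪ {0}` means: `x = 0` or `0 < σ x`
  have hmem : ∀ x : F,
      x ∈ {x : F | ∃ u ∈ (Units.posSubgroup ℝ).comap (Units.map (σ : F →* ℝ)), (u : F) = x} ∪ {0} ↔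
        x = 0 ∨ 0 < σ x := by
    intro x
    simp only [Set.union_singleton, Set.mem_insert_iff, Set.mem_setOf_eq, Subgroup.mem_comap,
      Units.mem_posSubgroup, Units.coe_map, MonoidHom.coe_coe]
    constructor
    · rintro (rfl | ⟨u, hu, rfl⟩)
      · exact Or.inl rfl
      · exact Or.inr hu
    · rintro (rfl | hx)
      · exact Or.inl rfl
      · have hx0 : x ≠ 0 := by
          rintro rfl
          simp at hx
        exact Or.inr ⟨Units.mk0 x hx0, by simpa using hx, Units.val_mk0 _⟩
  intro a ha b hb
  rw [hmem] at ha hb ⊢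
  rcases ha with rfl | ha
  · simpa using hb
  rcases hb with rfl | hb
  · exact Or.inr (by simpa using ha)
  · exact Or.inr (by rw [map_add]; exact add_pos ha hb)

/-- **IUTchIII:Rmk3.6.2(i) (b)** (kurims p.109 l.16–20), typing record: the UNPRIMED schema FAILS at the
positive cone of every real place `σ : F →+* ℝ` of every field `F` (e.g. every number field with a real
embedding), not only at `ℚ_{>0} ⊆ ℚ^×`. PROVED. [claim: Mochizuki2012, status: disputed] -/
theorem not_Remark362i_Sunits_posCone (σ : F →+* ℝ) :
    ¬ Remark362i_Sunits (F := F) ((Units.posSubgroup ℝ).comap (Units.map (σ : F →* ℝ))) :=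
  fun h => h (posCone_ne_top σ) (isAdditivelyClosed_posCone σ)

/-- **IUTchIII:Rmk3.6.2(i) (b)** (kurims p.109 l.18–20 «that do not arise as the multiplicative group of
some subfield of `F_mod`»), typing record: the positive cone of a real place is the unit group of NO
subfield (`-1` lies in every subfield) — so the failures of §3/§4 are NOT excluded by print's subfield
clause under the `+`-only reading `IsAdditivelyClosed`; the faithful repair is the module reading
(`not_sub_closed_of_not_subfield`, closure under `+` and `−`) or the primed hypothesis
(`Remark362i_Sunits'_holds`). PROVED. [claim: Mochizuki2012, status: disputed] -/
theorem posCone_not_subfield (σ : F →+* ℝ) :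
    ¬ ∃ k : Subfield F, (k : Set F) =
      {x : F | ∃ u ∈ (Units.posSubgroup ℝ).comap (Units.map (σ : F →* ℝ)), (u : F) = x} ∪ {0} := by
  rintro ⟨k, hk⟩
  have hneg : (-1 : F) ∈ (k : Set F) := k.neg_mem k.one_mem
  rw [hk] at hneg
  simp only [Set.union_singleton, Set.mem_insert_iff, Set.mem_setOf_eq, Subgroup.mem_comap,
    Units.mem_posSubgroup, Units.coe_map, MonoidHom.coe_coe] at hneg
  rcases hneg with h | ⟨u, hu, huv⟩
  · norm_num at h
  · have : σ ((u : F)) = -1 := by rw [huv, map_neg, map_one]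
    rw [this] at hu
    norm_num at hu

end PosCone

end GlobalFrobenioidModels

end Literature.IUT.LogThetaLattice
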